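import Mathlib
import Literature.Analysis.FluidPDE.Tao2016AveragedNS.ShiftSetCascadeFlows
import Literature.Analysis.FluidPDE.Tao2016AveragedNS.ShiftSetCascadeFlux
import Summits.NavierStokesRegularity.NavierStokesRegularity.Theorems.TaoLadderRungTwoFlatCertificateGlueCheckerAssembleVectorOn
import HarnessLib

/-!
# Certificate glue on a shift set `𝕊`, XXVIII-c: THE CHAIN CHECKER IN THE VECTOR LAYOUT — the step record `VRec` (remainder VECTORS `E`, `E'`,
  per-row radii `ρ`, transport `T`, box `[lo, hi]`, `K`, `δ`), the definitional node / hull families `nodeOfV` / `hullOfV`, the hand-over test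
  (`E'_c + A ≤ E_c` of the next record, componentwise), and `StepCert j` of the definitional mesh from the tests of record `j`
  (helper for items stmt-NavierStokesRegularity-22987 `FlatGapCertificatesV2` (crux K_A♭ of route TaoLadderRungTwoFlat) and stmt-24295 K_A₂(64);
  cell harvest/h2-tao-ladder, p1 g16; theory-1 A-73 / A-75)

Vector twin of glue XXVIII / XXVIII-b (`StepRec`, `nodeOf`, `hullOfB`, `handsOver`, `stepCert_of_rec_box`, `inBox_of_hullOfB`): the node family
`nodeOfV` is `PInParaV` of the start data, the hull family `hullOfV j` the product tube of step `j` fattened by `A j·ω`; `stepCert_of_recV` is glue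
XXVII-c `stepCert_of_checksV` with the three inclusions discharged definitionally and by the hand-over (monotone in the remainder vector);
`inBox_of_hullOfV` puts every hull state in the weighted box by the cover test (C13v).

HONEST FRAMING: Tao-type MODEL lattices (Tao 2016 §4/§6 vocabulary, shift-set parametrised); soundness of a checker — NO certificate instance exists
in the tree, nothing is certified here, no stub is closed, nothing here is a statement about the Navier–Stokes equations.
-/

-- the sub-problem namespace repeats the summit name by design (D-0017)
set_option linter.dupNamespace false

namespace Summit.NavierStokesRegularity.NavierStokesRegularity.Theorems

open Set Finset Literature.Analysis.FluidPDE Literature.Analysis.FluidPDE.TaoCascade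
open Summit.NavierStokesRegularity.NavierStokesRegularity.Theorems.TaylorModelCert
open Summit.NavierStokesRegularity.NavierStokesRegularity.Theorems.TaylorModelReadout

namespace CertificateGlueOn

/-- **ONE VECTOR-LAYOUT STEP RECORD** (dyadic vectors / matrices; `h`, `A`, `A'`, `K` rational). [cite: Zgliczynski2002C1Lohner, §3–4 (Lohner-type parallelepiped frames); cell certificate format, step record, vector remainder] -/
structure VRec where
  /-- start centre (weighted coordinates) -/
  x : Array Dyad
  /-- start frame -/
  C : Array (Array Dyad)
  /-- start frame radii -/
  r : Array Dyad
  /-- start remainder VECTOR -/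
  E : Array Dyad
  /-- landing centre -/
  x' : Array Dyad
  /-- landing frame -/
  Cn : Array (Array Dyad)
  /-- coordinate transport (`ξ' = T ξ`) -/
  T : Array (Array Dyad)
  /-- landing frame radii -/
  r' : Array Dyad
  /-- landing remainder VECTOR (before the input allowance) -/
  E1 : Array Dyad
  /-- centre bound `|x_c| ≤ mC` -/
  mC : Dyad
  /-- per-row frame radii `Σ_j |C_cj| r_j ≤ ρ_c` -/
  ρ : Array Dyad
  /-- hull radius `ρ_c + E_c ≤ ρs` -/
  ρs : Dyad
  /-- step length -/
  h : ℚ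
  /-- input (Grönwall) allowance of the step -/
  A : ℚ
  /-- cover margin `A' > A` -/
  A' : ℚ
  /-- lower box vector (weighted coordinates) -/
  lo : Array Dyad
  /-- upper box vector (weighted coordinates) -/
  hi : Array Dyad
  /-- Lipschitz constant of the truncated field on the box -/
  K : ℚ
  /-- input defect on the box -/
  δ : Dyad

variable {m : ℕ} {Kb Ka : ℤ}

/-- The node family DEFINED by the start data of the records. [folklore] -/
def nodeOfV (Kb Ka : ℤ) (ωq : Fin m → ℤ → ℚ) (rec : ℕ → VRec) (j : ℕ) (y : Fin m → ℤ → ℝ) : Prop :=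
  PInParaV Kb Ka (fun i k => (ωq i k : ℝ)) (dvec (n := m * winLen Kb Ka) (rec j).x) (dmat (n := m * winLen Kb Ka) (rec j).C)
    (dvec (n := m * winLen Kb Ka) (rec j).r) (dvec (n := m * winLen Kb Ka) (rec j).E) y

/-- The hull family DEFINED as the time-resolved product tube of step `j` (table `V` on its own box), fattened by `A j`. [folklore] -/
def hullOfV (Kb Ka : ℤ) (shifts : List (ℤ × ℤ × ℤ)) (αq : Fin m → Fin m → Fin m → ℤ × ℤ × ℤ → ℚ) (ωq : Fin m → ℤ → ℚ) (prec : ℕ)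
    (Sp Sm : IntervalD) (rec : ℕ → VRec) (j : ℕ) (y : Fin m → ℤ → ℝ) : Prop :=
  ∃ u ∈ Icc (0 : ℝ) ((rec j).h : ℝ), ∃ q' : Fin m → ℤ → ℝ,
    ProdTube Kb Ka (fun i k => (ωq i k : ℝ)) (dvec (n := m * winLen Kb Ka) (rec j).x) (dvec (n := m * winLen Kb Ka) (rec j).ρ)
      (dvec (n := m * winLen Kb Ka) (rec j).E) (vOf Kb Ka shifts (coefBoxOf prec αq ωq Sp Sm) (rec j).lo (rec j).hi) u q' ∧
    ∀ i k, -Kb ≤ k → k ≤ Ka → |y i k - q' i k| ≤ ((rec j).A : ℝ) * (ωq i k : ℝ)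

/-- **The hand-over test**: record `s'` starts with the landing centre / frame / radii of `s` (literally) and a remainder vector dominating
`E'_c + A` componentwise. [folklore] -/
def checkHandsOverV (n : ℕ) (s s' : VRec) : Bool :=
  decide (s'.x = s.x') && decide (s'.C = s.Cn) && decide (s'.r = s.r') &&
    (List.range n).all fun c => decide (dyadToRat (dgetD s.E1 c) + s.A ≤ dyadToRat (dgetD s'.E c))

/-- **Hand-over**: the landing parallelepiped of `s` (remainder `E'_c + A`) lies in the start node of `s'`. [folklore] -/
theorem node_of_checkHandsOverV {ωq : Fin m → ℤ → ℚ} {s s' : VRec} (h : checkHandsOverV (m * winLen Kb Ka) s s' = true)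
    {y : Fin m → ℤ → ℝ}
    (hy : PInParaV Kb Ka (fun i k => (ωq i k : ℝ)) (dvec (n := m * winLen Kb Ka) s.x') (dmat (n := m * winLen Kb Ka) s.Cn)
      (dvec (n := m * winLen Kb Ka) s.r') (fun c => dvec (n := m * winLen Kb Ka) s.E1 c + (s.A : ℝ)) y) :
    PInParaV Kb Ka (fun i k => (ωq i k : ℝ)) (dvec (n := m * winLen Kb Ka) s'.x) (dmat (n := m * winLen Kb Ka) s'.C)
      (dvec (n := m * winLen Kb Ka) s'.r) (dvec (n := m * winLen Kb Ka) s'.E) y := by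
  simp only [checkHandsOverV, Bool.and_eq_true, decide_eq_true_eq, List.all_eq_true, List.mem_range] at h
  obtain ⟨⟨⟨hx, hC⟩, hr⟩, hE⟩ := h
  rw [hx, hC, hr]
  refine pinParaV_mono (fun c => ?_) hy
  have := (Rat.cast_le (K := ℝ)).mpr (hE c c.isLt)
  simp only [Rat.cast_add, cast_dyadToRat] at this
  simpa [dvec] using this

/-- **`StepCert j` OF THE DEFINITIONAL MESH (PRODUCT-TUBE HULLS) FROM THE TESTS OF RECORD `j` AND THE HAND-OVER TO RECORD `j+1`.**
[cite: Zgliczynski2002C1Lohner, §3–4 (Lohner-type parallelepiped frames and the C¹/variational enclosure); cell certificate format, chain checker, vector remainder] -/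
theorem stepCert_of_recV (hKb : 0 ≤ Kb) (hKa : 1 ≤ Ka) {shifts : List (ℤ × ℤ × ℤ)} (hnd : shifts.Nodup)
    (h𝕊 : IsNearestNeighbourSet shifts.toFinset) {q : ℚ} (hq : 0 < 1 + (q : ℝ))
    {αq : Fin m → Fin m → Fin m → ℤ × ℤ × ℤ → ℚ} {ωq : Fin m → ℤ → ℚ} (hω : ∀ i k, 0 < ωq i k)
    {prec p kexp nexp : ℕ} {Sp Sm : IntervalD} (hSp : sqrtCheck prec (1 + q) Sp = true)
    (hSm : sqrtCheck prec (1 / (1 + q)) Sm = true) {M : ℤ → ℝ} {t : ℕ → ℝ} {rec : ℕ → VRec} {j : ℕ}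
    {bD : Dyad} {Eb Et : ℚ}
    (hb : 0 ≤ bD.toReal) (hmC : 0 ≤ (rec j).mC.toReal) (hρs : 0 ≤ (rec j).ρs.toReal)
    (hAA' : (rec j).A < (rec j).A') (ht : t (j + 1) - t j = ((rec j).h : ℝ))
    (hnext : checkHandsOverV (m * winLen Kb Ka) (rec j) (rec (j + 1)) = true)
    (hchkB : checkB m Kb Ka shifts (coefBoxOf prec αq ωq Sp Sm) bD = true)
    (h2 : checkAbsLe (m * winLen Kb Ka) (rec j).x (rec j).mC = true)
    (h3 : checkRowsLe (m * winLen Kb Ka) (rec j).C (rec j).r (rec j).ρ = true)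
    (hhull : checkHull (m * winLen Kb Ka) (rec j).ρ (rec j).E (rec j).ρs = true)
    (h6 : checkRowsLe (m * winLen Kb Ka) (rec j).T (rec j).r (rec j).r' = true)
    (h8 : checkERecV (m * winLen Kb Ka) p (dyadToRat bD) (dyadToRat (rec j).mC) (dyadToRat (rec j).ρs) (rec j).h
      (dPArr (m * winLen Kb Ka) prec (IntervalD.polyLevelsA (m * winLen Kb Ka) prec
        (IntervalD.jetLevelsA (m * winLen Kb Ka) (pqBoxA Kb Ka prec shifts (coefBoxOf prec αq ωq Sp Sm)) prec
          (pointBoxA (m * winLen Kb Ka) (rec j).x) p) p (ofRatRel prec (rec j).h)) (rec j).x')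
      (kappaArr prec (m * winLen Kb Ka) (rec j).Cn (rec j).T
        (vcolsA Kb Ka prec shifts (coefBoxOf prec αq ωq Sp Sm) p
          (IntervalD.jetLevelsA (m * winLen Kb Ka) (pqBoxA Kb Ka prec shifts (coefBoxOf prec αq ωq Sp Sm)) prec
            (hullBoxA (m * winLen Kb Ka) (rec j).x (rec j).ρ (rec j).E) p) (ofRatRel prec (rec j).h) (rec j).C) (rec j).r)
      (nveArr (m * winLen Kb Ka) (IntervalD.polyLevelsA (m * winLen Kb Ka) prec
        (IntervalD.varJetLevelsA (m * winLen Kb Ka) (pqBoxA Kb Ka prec shifts (coefBoxOf prec αq ωq Sp Sm)) prec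
          (IntervalD.jetLevelsA (m * winLen Kb Ka) (pqBoxA Kb Ka prec shifts (coefBoxOf prec αq ωq Sp Sm)) prec
            (hullBoxA (m * winLen Kb Ka) (rec j).x (rec j).ρ (rec j).E) p) (symBoxA (m * winLen Kb Ka) (rec j).E) p) p
          (ofRatRel prec (rec j).h)))
      (rec j).E1 = true)
    (h9 : checkGuardV (dyadToRat bD) (dyadToRat (rec j).mC) (dyadToRat (rec j).ρs) (rec j).h = true)
    (h13 : checkCoverV m Kb Ka shifts (coefBoxOf prec αq ωq Sp Sm) (rec j).x (rec j).ρ (rec j).E (rec j).lo (rec j).hi (rec j).h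
      (rec j).A' = true)
    (h10 : checkLipT m Kb Ka shifts (coefBoxOf prec αq ωq Sp Sm) (rec j).lo (rec j).hi (rec j).K = true)
    (h11 : checkDefectT m Kb Ka prec shifts αq ωq Eb Et (rec j).lo (rec j).hi Sp Sm (rec j).δ = true)
    (h12 : checkGronwallK (rec j).K (dyadToRat (rec j).δ) (rec j).h (rec j).A kexp nexp = true) :
    StepCert shifts.toFinset (q : ℝ) (fun i₁ i₂ i μ => (αq i₁ i₂ i μ : ℝ)) Kb Ka (Eb : ℝ) (Et : ℝ) M t
      (nodeOfV Kb Ka ωq rec) (hullOfV Kb Ka shifts αq ωq prec Sp Sm rec) j :=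
  stepCert_of_checksV hKb hKa hnd h𝕊 hq hω hSp hSm hb hmC hρs hAA' ht hchkB h2 h3 hhull h6 h8 h9 h13 h10 h11 h12 (fun _ hy => hy)
    (fun u hu _ q' hq' hnear => ⟨u, hu, q', hq', hnear⟩) (fun _ hy => node_of_checkHandsOverV hnext hy)

/-- **EVERY HULL STATE LIES IN THE WEIGHTED BOX** `[lo, hi]·ω` of its step, by the cover test (C13v). [folklore] -/
theorem inBox_of_hullOfV {shifts : List (ℤ × ℤ × ℤ)} (hnd : shifts.Nodup)
    {αq : Fin m → Fin m → Fin m → ℤ × ℤ × ℤ → ℚ} {ωq : Fin m → ℤ → ℚ} (hω : ∀ i k, 0 < ωq i k)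
    {prec : ℕ} {Sp Sm : IntervalD} {rec : ℕ → VRec} {j : ℕ} (hAA' : (rec j).A ≤ (rec j).A')
    (h13 : checkCoverV m Kb Ka shifts (coefBoxOf prec αq ωq Sp Sm) (rec j).x (rec j).ρ (rec j).E (rec j).lo (rec j).hi (rec j).h
      (rec j).A' = true)
    {y : Fin m → ℤ → ℝ} (hy : hullOfV Kb Ka shifts αq ωq prec Sp Sm rec j y) :
    InBoxOn Kb Ka (wbox Kb Ka (fun i k => (ωq i k : ℝ)) (rec j).lo) (wbox Kb Ka (fun i k => (ωq i k : ℝ)) (rec j).hi) y := by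
  obtain ⟨u, hu, q', htube, hnear⟩ := hy
  have hAA'r : ((rec j).A : ℝ) ≤ ((rec j).A' : ℝ) := by exact_mod_cast hAA'
  exact inBox_of_checkCoverV (Kb := Kb) (Ka := Ka) hnd hω h13 hu htube fun i k hk1 hk2 => (hnear i k hk1 hk2).trans
    (mul_le_mul_of_nonneg_right hAA'r (by exact_mod_cast (hω i k).le))

/-- **Box consequence, weighted form**: on the window, a hull state satisfies `ω·lo_c ≤ y i k ≤ ω·hi_c`, `c = idx(i,k)`. [folklore] -/
theorem hull_coord_boundsV {shifts : List (ℤ × ℤ × ℤ)} (hnd : shifts.Nodup)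
    {αq : Fin m → Fin m → Fin m → ℤ × ℤ × ℤ → ℚ} {ωq : Fin m → ℤ → ℚ} (hω : ∀ i k, 0 < ωq i k)
    {prec : ℕ} {Sp Sm : IntervalD} {rec : ℕ → VRec} {j : ℕ} (hAA' : (rec j).A ≤ (rec j).A')
    (h13 : checkCoverV m Kb Ka shifts (coefBoxOf prec αq ωq Sp Sm) (rec j).x (rec j).ρ (rec j).E (rec j).lo (rec j).hi (rec j).h
      (rec j).A' = true)
    {y : Fin m → ℤ → ℝ} (hy : hullOfV Kb Ka shifts αq ωq prec Sp Sm rec j y) (i : Fin m) {k : ℤ} (hk : -Kb ≤ k ∧ k ≤ Ka) :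
    (ωq i k : ℝ) * (dgetD (rec j).lo (idxOf Kb Ka i k hk)).toReal ≤ y i k ∧
      y i k ≤ (ωq i k : ℝ) * (dgetD (rec j).hi (idxOf Kb Ka i k hk)).toReal := by
  have h := inBox_of_hullOfV hnd hω hAA' h13 hy i k hk.1 hk.2
  simp only [wbox, dif_pos hk] at h
  exact h

end CertificateGlueOn

end Summit.NavierStokesRegularity.NavierStokesRegularity.Theorems
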